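import Summits.ResolutionOfSingularities.ResolutionOfSingularities.Theorems.MarkedTransferCampaignW46CuspStaircaseDichotomy
import HarnessLib

/-!
# [OURS · L1 W4.6, rung (iii)] The cusp staircase — fibre uniqueness: over a cusp point the blow-up has at most ONE
# singular point (cell res-hironaka, LADDER-RESOLUTION rung L, D-0089; slot W4.6, seat res-L1-s46-pv-5; host route
# MarkedTransfer, `--supports stmt-ResolutionOfSingularities-16155 --as helper`)

HONEST FRAMING. Nothing here is a statement of H. Hironaka's manuscript (2017-03-23, [Hironaka2017]) and nothing here
asserts that any statement of it holds. Pure blow-up geometry and commutative algebra about the OURS ring-level notions of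
`…CuspStaircase.lean`, proved from the tree's blow-up library — the construction behind `IsBlowup.exists_chart_morphism`
(`BlowupStalkCharts.lean`: blow-ups commute with the flat base change `Spec 𝒪_{X,s} → X`, `IsBlowup.pullback_snd_of_flat`,
and are unique, `IsBlowup.unique`; the charts `affineBlowup.chartι` cover `Proj 𝒪_{X,s}[𝔪 t]`,
`affineBlowup.iSup_chartOpen_eq_top`; `exists_stalk_ringHom_of_chart`) and the chart quotient `B_j/(c_j) ≅ (R/𝔪)[T]`
(`chartQuotEquiv`, Stacks 0BIQ) — plus this seat's `…CuspStaircaseProof` (`Cusp.colon_span_pow_mul_eq`,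
`Cusp.isUnit_add_of_mem`, `MohWindow.chart_isRegularLocalRing_and_not_mem_sq`). No typed candidate carrier of the
manuscript is consumed; no FACT-LIST premise; no `sorry`; axioms standard. Two declarations raise `maxHeartbeats` (the
comparison with `Proj` over `Spec 𝒪_{X,s}` elaborates large terms, exactly as in the tree's `IsBlowup.exists_chart_morphism`).
AI review is weaker than expert review.

## What is proved (namespace `…Theorems.CampaignW46.Cusp`)

* `isMaximal_idealOfVars_of_field` — the ideal of variables of a polynomial ring over a field is maximal.
* `chartPrime_eq_of_forall_mem` — **the origin of a chart is one point**: two primes of the chart ring `B_j = R[𝔪/c_j]`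
  (`R` regular local, `c` a regular system of parameters generating `𝔪`) lying over `𝔪` and containing all chart
  generators `c_i/c_j`, `i ≠ j`, coincide (modulo `c_j` both are the ideal of variables of `(R/𝔪)[T_i : i ≠ j]`).
* `chartIndex_eq_zero_of_le` — for ANY chart presentation `Spec B_j → X′` through a point over a cusp point
  `(y^b + u x^d)`, `1 ≤ b < d`, at which the transform `J′ = (J𝒪 : 𝓘_E^b)` is singular (`ord ≥ b`): `j = 0` (the chart
  `t = x`) and the prime contains `y/x` (the computation of `cuspShape_transform_of_le`, run on a given presentation).
* `eq_of_le_of_le` — **fibre uniqueness**: any two points of the blow-up over such a cusp point at which the transform has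
  order `≥ b` are EQUAL (both are the image of the chart-`x` origin through `X′ ×_X Spec 𝒪_{X,s} ≅ Proj 𝒪_{X,s}[𝔪 t]`).
  K4.6 / ATLAS-RUN j259568: «ONE singular closed point in the first fibre iff n > 2p».

## References

* `Theorems/MarkedTransferCampaignW46CuspStaircase*.lean` (this seat); L/res-L0-k46/KILL-TEST-K4.6.md §2–§4.
* The Stacks Project, Tag 0804 (charts of a blowing up), Tag 0805 (flat base change), Tag 0BIQ — locators carried by the
  tree files cited above. [StacksProject]
-/

noncomputable section

set_option linter.dupNamespace false -- mandated namespace of this single-conjunct summit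

open CategoryTheory CategoryTheory.Limits AlgebraicGeometry TopologicalSpace IsLocalRing

namespace Summit.ResolutionOfSingularities.ResolutionOfSingularities.Theorems

namespace CampaignW46

open Literature.AlgebraicGeometry.Resolution
open Literature.AlgebraicGeometry.Hironaka2017.S02Preliminaries
open Literature.AlgebraicGeometry.Hironaka2017.Datum
open Scheme.IdealSheafData

universe u

namespace Cusp

/-! ## The ideal of variables of a polynomial ring over a field is maximal -/

/-- Over a field, the ideal of variables `(T_i)_i ⊆ k[T_i : i ∈ σ]` is maximal (the kernel of the constant
coefficient, which is onto `k`). [folklore] -/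
theorem isMaximal_idealOfVars_of_field (σ : Type*) (k : Type u) [Field k] :
    (MvPolynomial.idealOfVars σ k).IsMaximal := by
  have hker : RingHom.ker (MvPolynomial.constantCoeff : MvPolynomial σ k →+* k) = MvPolynomial.idealOfVars σ k := by
    ext q
    rw [RingHom.mem_ker, ← pow_one (MvPolynomial.idealOfVars σ k), MvPolynomial.mem_pow_idealOfVars_iff']
    constructor
    · intro hq m hm
      have hm0 : m = 0 := (Finsupp.degree_eq_zero_iff m).mp (Nat.lt_one_iff.mp hm)
      subst hm0
      exact hq
    · intro h
      exact h 0 (by simp)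
  rw [← hker]
  exact RingHom.ker_isMaximal_of_surjective _ fun a => ⟨MvPolynomial.C a, MvPolynomial.constantCoeff_C _ a⟩

/-! ## The origin prime of a chart is unique -/

section Origin

variable {R : Type u} [CommRing R] [IsRegularLocalRing R] {n : ℕ}

/-- **The origin of the chart `D₊(c_j t)` is a well-defined point**: for a regular local ring `R` with regular system of
parameters `c` (all of `𝔪`), two primes of the chart ring `B_j = R[𝔪/c_j]` lying over `𝔪` and containing every chart
generator `e_i = c_i/c_j`, `i ≠ j`, are equal — modulo `c_j` the chart ring is the polynomial ring `(R/𝔪)[T_i : i ≠ j]`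
(tree `chartQuotEquiv`, Stacks 0BIQ), in which the only prime containing all the variables is the maximal ideal of
variables. [cite: StacksProject, Tag 0BIQ] -/
theorem chartPrime_eq_of_forall_mem (hd : (maximalIdeal R).spanFinrank = n) (c : Fin n → R)
    (hc : Ideal.span (Set.range c) = maximalIdeal R) (j : Fin n)
    (𝔴 𝔴' : Ideal (chartRing c j)) [𝔴.IsPrime] [𝔴'.IsPrime]
    (h𝔴 : 𝔴.comap (chartBase c j) = maximalIdeal R) (h𝔴' : 𝔴'.comap (chartBase c j) = maximalIdeal R)
    (hi : ∀ i, i ≠ j → chartGen c j i ∈ 𝔴) (hi' : ∀ i, i ≠ j → chartGen c j i ∈ 𝔴') : 𝔴 = 𝔴' := by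
  classical
  haveI hImax : (Ideal.span (Set.range c)).IsMaximal := by rw [hc]; exact maximalIdeal.isMaximal R
  have hz : Ideal.span (Set.range (Fin.append c (fun k : Fin 0 => Fin.elim0 k))) = maximalIdeal R := by
    rw [← hc]
    congr 1
    ext r
    constructor
    · rintro ⟨k, rfl⟩
      refine Fin.addCases (fun k => ⟨k, ?_⟩) (fun k => Fin.elim0 k) k
      rw [Fin.append_left]
    · rintro ⟨k, rfl⟩
      exact ⟨Fin.castAdd 0 k, by rw [Fin.append_left]⟩
  have hqr : IsQuasiRegular c :=
    isQuasiRegular_centre c (fun k : Fin 0 => Fin.elim0 k) hz (by rw [hd, Nat.add_zero])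
  letI : Field (R ⧸ Ideal.span (Set.range c)) := Ideal.Quotient.field _
  -- `θ : B_j → B_j/(c_j) ≅ (R/𝔪)[T]`
  set ε := chartQuotEquiv c j hqr with hε
  set θ : chartRing c j →+* MvPolynomial {i : Fin n // i ≠ j} (R ⧸ Ideal.span (Set.range c)) :=
    ε.symm.toRingHom.comp (Ideal.Quotient.mk (Ideal.span {chartBase c j (c j)})) with hθ
  have hθsurj : Function.Surjective θ := fun y => by
    obtain ⟨z, hz⟩ := Ideal.Quotient.mk_surjective (ε y)
    refine ⟨z, ?_⟩
    simp only [hθ, RingHom.comp_apply, RingEquiv.toRingHom_eq_coe, RingHom.coe_coe, hz, RingEquiv.symm_apply_apply]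
  have hθX : ∀ i (hi : i ≠ j), θ (chartGen c j i) = MvPolynomial.X ⟨i, hi⟩ := by
    intro i hi
    have h1 : ε.symm (Ideal.Quotient.mk _ (chartGen c j i)) = MvPolynomial.X ⟨i, hi⟩ := by
      apply ε.injective
      rw [RingEquiv.apply_symm_apply, hε, chartQuotEquiv_apply, chartQuotMap_X]
    simp only [hθ, RingHom.comp_apply, RingEquiv.toRingHom_eq_coe, RingHom.coe_coe, h1]
  have hθker : ∀ z, θ z = 0 ↔ z ∈ Ideal.span {chartBase c j (c j)} := by
    intro z
    simp only [hθ, RingHom.comp_apply, RingEquiv.toRingHom_eq_coe, RingHom.coe_coe,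
      map_eq_zero_iff _ ε.symm.injective, Ideal.Quotient.eq_zero_iff_mem]
  set m₀ : Ideal (MvPolynomial {i : Fin n // i ≠ j} (R ⧸ Ideal.span (Set.range c))) :=
    MvPolynomial.idealOfVars _ _ with hm₀
  have hm₀max : m₀.IsMaximal := isMaximal_idealOfVars_of_field _ _
  -- every prime over `𝔪` containing the chart generators is `θ⁻¹(m₀)`
  have key : ∀ 𝔭 : Ideal (chartRing c j), 𝔭.IsPrime → 𝔭.comap (chartBase c j) = maximalIdeal R →
      (∀ i, i ≠ j → chartGen c j i ∈ 𝔭) → 𝔭 = m₀.comap θ := by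
    intro 𝔭 h𝔭p h𝔭c h𝔭i
    have hcj : chartBase c j (c j) ∈ 𝔭 := by
      rw [← Ideal.mem_comap, h𝔭c, ← hc]
      exact Ideal.subset_span ⟨j, rfl⟩
    have hker : RingHom.ker θ ≤ 𝔭 := by
      intro z hz
      have hz' : z ∈ Ideal.span {chartBase c j (c j)} := (hθker z).mp hz
      exact (Ideal.span_singleton_le_iff_mem _).mpr hcj hz'
    have hcm : (𝔭.map θ).comap θ = 𝔭 := by
      rw [Ideal.comap_map_of_surjective _ hθsurj, ← RingHom.ker_eq_comap_bot, sup_eq_left.mpr hker]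
    have hne : 𝔭.map θ ≠ ⊤ := fun h => h𝔭p.ne_top (by rw [← hcm, h, Ideal.comap_top])
    have hle : m₀ ≤ 𝔭.map θ := by
      rw [hm₀, MvPolynomial.idealOfVars, Ideal.span_le]
      rintro _ ⟨⟨i, hi⟩, rfl⟩
      rw [SetLike.mem_coe, ← hθX i hi]
      exact Ideal.mem_map_of_mem θ (h𝔭i i hi)
    have heq : 𝔭.map θ = m₀ := (hm₀max.eq_of_le hne hle).symm
    rw [← heq, hcm]
  rw [key 𝔴 ‹_› h𝔴 hi, key 𝔴' ‹_› h𝔴' hi']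

end Origin

/-! ## A singular point over a cusp point sits at the origin of the chart `t = x` -/

section Local

variable {X X' : Scheme.{u}} {π : X' ⟶ X}

set_option maxHeartbeats 800000 in
/-- For ANY chart presentation `q : Spec B_j → X′` through a point `x′` over a cusp point `s` (`J_s = (y^b + u x^d)`,
`1 ≤ b < d`) at which the transform is singular (`ord_{x′} J′ ≥ b`): the chart is the chart `t = x` (`j = 0`) and its
prime contains the other chart generator `y/x` — `x′` is the origin of that chart (the computation of
`cuspShape_transform_of_le`, run on a given presentation). [cite: StacksProject, Tag 0804] -/
theorem chartIndex_eq_zero_of_le [IsLocallyNoetherian X'] {Y : Closeds X}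
    {J : X.IdealSheafData} {b d : ℕ} (hb : 1 ≤ b) (hbd : b < d) {s : X} {x' : X'} (hx : π x' = s)
    [IsRegularLocalRing (X.presheaf.stalk s)] (hdim : (maximalIdeal (X.presheaf.stalk s)).spanFinrank = 2)
    (c : Fin 2 → X.presheaf.stalk s) (hc : Ideal.span (Set.range c) = maximalIdeal _)
    (hY : stalkIdeal (vanishingIdeal Y) s = maximalIdeal _) {u : X.presheaf.stalk s} (hu : IsUnit u)
    (hJ : stalkIdeal J s = Ideal.span {c 1 ^ b + u * c 0 ^ d})
    (j : Fin 2) (q : Spec (.of (chartRing c j)) ⟶ X') (w : Spec (.of (chartRing c j))) (hq : q w = x')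
    [IsIso (q.stalkMap w)]
    (hsq : q ≫ π = Spec.map (CommRingCat.ofHom (chartBase c j)) ≫ X.fromSpecStalk s)
    (hle : (b : ℕ∞) ≤ idealOrder (controlledTransform π (vanishingIdeal Y) J b) x') :
    j = 0 ∧ (∀ i, i ≠ j → chartGen c j i ∈ w.asIdeal) ∧
      w.asIdeal.comap (chartBase c j) = maximalIdeal (X.presheaf.stalk s) := by
  classical
  subst hx
  obtain ⟨χ, hχ₀, hloc, h𝔴⟩ :=
    exists_stalk_ringHom_of_chart π x' (CommRingCat.ofHom (chartBase c j)) q w hq hsq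
  have hχ : ∀ a, χ (chartBase c j a) = (π.stalkMap x').hom a := fun a => hχ₀ a
  have h𝔴' : w.asIdeal.comap (chartBase c j) = maximalIdeal (X.presheaf.stalk (π x')) := h𝔴
  clear hχ₀ h𝔴
  obtain ⟨m, rfl⟩ : ∃ m, d = b + m := Nat.exists_eq_add_of_le hbd.le
  have hm1 : 1 ≤ m := by omega
  letI := χ.toAlgebra
  haveI : IsLocalization.AtPrime (X'.presheaf.stalk x') w.asIdeal := hloc
  have halg : ∀ z, (algebraMap (chartRing c j) (X'.presheaf.stalk x') :
      chartRing c j →+* X'.presheaf.stalk x') z = χ z := fun _ => rfl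
  obtain ⟨hLreg, ht1, ht2⟩ :=
    MohWindow.chart_isRegularLocalRing_and_not_mem_sq hdim c hc j w.asIdeal h𝔴' (X'.presheaf.stalk x')
  haveI := hLreg
  haveI := isDomain_of_isRegularLocalRing (X'.presheaf.stalk x')
  obtain ⟨ψ, hψ⟩ : ∃ ψ : X.presheaf.stalk (π x') →+* X'.presheaf.stalk x', ψ = (π.stalkMap x').hom :=
    ⟨_, rfl⟩
  have hχψ : ∀ a, χ (chartBase c j a) = ψ a := fun a => by rw [hψ]; exact hχ a
  rw [halg, hχψ] at ht1 ht2
  have hrel : ∀ i, ψ (c i) = ψ (c j) * χ (chartGen c j i) := by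
    rw [hψ]; exact stalkMap_apply_eq_mul_chartGen j χ hχ
  have ht0 : ψ (c j) ≠ 0 := fun h => ht2 (by rw [h]; exact zero_mem _)
  have hv : IsUnit (ψ u) := hu.map ψ
  have hcY : Ideal.span (Set.range c) = stalkIdeal (vanishingIdeal Y) (π x') := hc.trans hY.symm
  have hcYmap : (stalkIdeal (vanishingIdeal Y) (π x')).map ψ = Ideal.span {ψ (c j)} := by
    rw [← hcY, Ideal.map_span_range_eq_span_singleton _ c j _ hrel]
  have hJ' : ∀ G : X'.presheaf.stalk x', ψ (c 1 ^ b + u * c 0 ^ (b + m)) = ψ (c j) ^ b * G →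
      stalkIdeal (controlledTransform π (vanishingIdeal Y) J b) x' = Ideal.span {G} := by
    intro G hG
    have hJmap : (stalkIdeal J (π x')).map ψ = Ideal.span {ψ (c j) ^ b * G} := by
      rw [hJ, Ideal.map_span, Set.image_singleton, hG]
    rw [controlledTransform, stalkIdeal_colon, stalkIdeal_pow, stalkIdeal_comap_eq_map_stalkMap,
      stalkIdeal_comap_eq_map_stalkMap, ← hψ, hcYmap, hJmap]
    exact colon_span_pow_mul_eq ht0 G b
  have hJ'le : stalkIdeal (controlledTransform π (vanishingIdeal Y) J b) x' ≤
      maximalIdeal (X'.presheaf.stalk x') ^ b := (le_idealOrder_iff _ x' b).mp hle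
  have hnotunit : ∀ G : X'.presheaf.stalk x', ψ (c 1 ^ b + u * c 0 ^ (b + m)) = ψ (c j) ^ b * G →
      ¬ IsUnit G := by
    intro G hG hGu
    have h1 : stalkIdeal (controlledTransform π (vanishingIdeal Y) J b) x' = ⊤ := by
      rw [hJ' G hG]; exact Ideal.span_singleton_eq_top.mpr hGu
    have h2 : (⊤ : Ideal (X'.presheaf.stalk x')) ≤ maximalIdeal _ ^ b := h1 ▸ hJ'le
    have h3 : (1 : X'.presheaf.stalk x') ∈ maximalIdeal _ :=
      Ideal.pow_le_self (by omega) (h2 Submodule.mem_top)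
    exact (maximalIdeal.isMaximal _).ne_top ((Ideal.eq_top_iff_one _).mpr h3)
  have hL : ψ (c 1 ^ b + u * c 0 ^ (b + m)) = ψ (c 1) ^ b + ψ u * ψ (c 0) ^ (b + m) := by
    simp only [map_add, map_mul, map_pow]
  obtain rfl | rfl : j = 0 ∨ j = 1 := Fin.exists_fin_two.mp ⟨j, rfl⟩
  · have hG : ψ (c 1 ^ b + u * c 0 ^ (b + m)) =
        ψ (c 0) ^ b * (χ (chartGen c 0 1) ^ b + ψ u * ψ (c 0) ^ m) := by
      rewrite [hL, hrel 1]
      ring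
    have hε : χ (chartGen c 0 1) ∈ maximalIdeal (X'.presheaf.stalk x') := by
      by_contra hεm
      have hεu : IsUnit (χ (chartGen c 0 1)) := by
        by_contra h
        exact hεm ((IsLocalRing.mem_maximalIdeal _).mpr (mem_nonunits_iff.mpr h))
      exact hnotunit _ hG
        (isUnit_add_of_mem (hεu.pow b) (Ideal.mul_mem_left _ _ (Ideal.pow_mem_of_mem _ ht1 m hm1)))
    have hw : chartGen c 0 1 ∈ w.asIdeal := by
      rw [← halg] at hε
      exact (IsLocalization.AtPrime.to_map_mem_maximal_iff _ w.asIdeal _).mp hε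
    refine ⟨rfl, fun i hi => ?_, h𝔴'⟩
    obtain rfl : i = 1 := by
      rcases Fin.exists_fin_two.mp ⟨i, rfl⟩ with h | h
      · exact absurd h hi
      · exact h
    exact hw
  · exfalso
    have hG : ψ (c 1 ^ b + u * c 0 ^ (b + m)) =
        ψ (c 1) ^ b * (1 + ψ u * (ψ (c 1) ^ m * χ (chartGen c 1 0) ^ (b + m))) := by
      rewrite [hL, hrel 0]
      ring
    exact hnotunit _ hG (isUnit_add_of_mem isUnit_one
      (Ideal.mul_mem_left _ _ (Ideal.mul_mem_right _ _ (Ideal.pow_mem_of_mem _ ht1 m hm1))))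

set_option maxHeartbeats 400000 in
-- the comparison with `Proj` over `Spec 𝒪_{X,s}` elaborates large terms (as in the tree's `exists_chart_morphism`)
/-- **At most one singular point over a cusp point.** Let `π` be a blow-up along the ideal of a closed `Y` with
`𝓘_{Y,s} = 𝔪_s`, `𝒪_{X,s}` regular of embedding dimension `2` with regular system of parameters `c = (x, y)`, and
`J_s = (y^b + u x^d)` with `u` a unit, `1 ≤ b < d`. Then any two points `x₁, x₂ ∈ X′` over `s` at which the transform
`J′ = (J𝒪 : 𝓘_E^b)` has order `≥ b` are EQUAL: both are the image of the origin prime of the chart `t = x`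
(`chartIndex_eq_zero_of_le`, `chartPrime_eq_of_forall_mem`) under the chart morphism `Spec B_x → X′`, through the
identification of `X′ ×_X Spec 𝒪_{X,s}` with `Proj 𝒪_{X,s}[𝔪 t]` (blow-ups commute with flat base change and are unique;
the construction of the tree's `IsBlowup.exists_chart_morphism`). [cite: StacksProject, Tag 0804] -/
theorem eq_of_le_of_le [IsLocallyNoetherian X'] {Y : Closeds X} (hπ : IsBlowup π (vanishingIdeal Y))
    {J : X.IdealSheafData} {b d : ℕ} (hb : 1 ≤ b) (hbd : b < d) {s : X}
    [IsRegularLocalRing (X.presheaf.stalk s)] (hdim : (maximalIdeal (X.presheaf.stalk s)).spanFinrank = 2)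
    (c : Fin 2 → X.presheaf.stalk s) (hc : Ideal.span (Set.range c) = maximalIdeal _)
    (hY : stalkIdeal (vanishingIdeal Y) s = maximalIdeal _) {u : X.presheaf.stalk s} (hu : IsUnit u)
    (hJ : stalkIdeal J s = Ideal.span {c 1 ^ b + u * c 0 ^ d})
    {x₁ x₂ : X'} (h₁ : π x₁ = s) (h₂ : π x₂ = s)
    (hle₁ : (b : ℕ∞) ≤ idealOrder (controlledTransform π (vanishingIdeal Y) J b) x₁)
    (hle₂ : (b : ℕ∞) ≤ idealOrder (controlledTransform π (vanishingIdeal Y) J b) x₂) : x₁ = x₂ := by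
  classical
  have hcj : ∀ j, c j ∈ Ideal.span (Set.range c) := fun j =>
    Ideal.mem_span_range_self (f := c) (x := j)
  have hcY : Ideal.span (Set.range c) = stalkIdeal (vanishingIdeal Y) s := hc.trans hY.symm
  haveI : Flat (X.fromSpecStalk s) := flat_fromSpecStalk X s
  have hP : IsBlowup (pullback.snd π (X.fromSpecStalk s))
      (affineBlowup.idealSheaf (Ideal.span (Set.range c))) := by
    have h := hπ.pullback_snd_of_flat (X.fromSpecStalk s)
    rwa [comap_fromSpecStalk_eq_affineBlowupIdealSheaf, ← hcY] at h
  obtain ⟨e, he, -⟩ := (affineBlowup.isBlowup (Ideal.span (Set.range c))).unique hP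
  -- every singular point over `s` is the image of the origin prime of the chart `t = x`
  have key : ∀ x' : X', π x' = s → (b : ℕ∞) ≤ idealOrder (controlledTransform π (vanishingIdeal Y) J b) x' →
      ∃ w : Spec (.of (chartRing c 0)), (∀ i, i ≠ (0 : Fin 2) → chartGen c 0 i ∈ w.asIdeal) ∧
        w.asIdeal.comap (chartBase c 0) = maximalIdeal (X.presheaf.stalk s) ∧
        ((affineBlowup.chartι (c 0) (hcj 0) ≫ e.hom) ≫ pullback.fst π (X.fromSpecStalk s)) w = x' := by
    intro x' hx hle
    obtain ⟨y, hy⟩ := mem_range_pullback_fst_fromSpecStalk_of_eq π s (x' := x') hx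
    obtain ⟨z, rfl⟩ : ∃ z, e.hom z = y := ⟨e.inv y, by simp⟩
    have hz : z ∈ (⊤ : (affineBlowup (Ideal.span (Set.range c))).Opens) := trivial
    rw [← affineBlowup.iSup_chartOpen_eq_top c rfl] at hz
    obtain ⟨j, hzj⟩ := Opens.mem_iSup.mp hz
    obtain ⟨w, -, rfl⟩ := hzj
    have hiso : IsIso (((affineBlowup.chartι (c j) (hcj j) ≫ e.hom) ≫
        pullback.fst π (X.fromSpecStalk s)).stalkMap w) := by
      have h1 := isIso_stalkMap_pullback_fst_fromSpecStalk π s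
        ((affineBlowup.chartι (c j) (hcj j) ≫ e.hom) w)
      haveI : IsOpenImmersion (affineBlowup.chartι (c j) (hcj j) ≫ e.hom) := inferInstance
      have h2 : IsIso ((affineBlowup.chartι (c j) (hcj j) ≫ e.hom).stalkMap w) := inferInstance
      rw [Scheme.Hom.stalkMap_comp]
      exact @IsIso.comp_isIso _ _ _ _ _ _ _ h1 h2
    have hsq : ((affineBlowup.chartι (c j) (hcj j) ≫ e.hom) ≫ pullback.fst π (X.fromSpecStalk s)) ≫ π =
        Spec.map (CommRingCat.ofHom (chartBase c j)) ≫ X.fromSpecStalk s := by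
      rw [Category.assoc, pullback.condition, Category.assoc, reassoc_of% he, ← Category.assoc,
        affineBlowup.chartι_π (c j) (hcj j)]
    haveI := hiso
    obtain ⟨hj0, hmem, hcomap⟩ := chartIndex_eq_zero_of_le (π := π) hb hbd hx hdim c hc hY hu hJ j
      ((affineBlowup.chartι (c j) (hcj j) ≫ e.hom) ≫ pullback.fst π (X.fromSpecStalk s)) w hy hsq hle
    subst hj0
    exact ⟨w, hmem, hcomap, hy⟩
  obtain ⟨w₁, hm₁, hc₁, hq₁⟩ := key x₁ h₁ hle₁
  obtain ⟨w₂, hm₂, hc₂, hq₂⟩ := key x₂ h₂ hle₂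
  have hw : w₁ = w₂ :=
    PrimeSpectrum.ext (chartPrime_eq_of_forall_mem hdim c hc 0 w₁.asIdeal w₂.asIdeal hc₁ hc₂ hm₁ hm₂)
  rw [← hq₁, ← hq₂, hw]

end Local

end Cusp

end CampaignW46

end Summit.ResolutionOfSingularities.ResolutionOfSingularities.Theorems

end
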